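import Literature.Probability.FitznerVanDerHofstad2017.NobleInstantiate
import HarnessLib

/-!
# Fitzner–van der Hofstad: the NoBLE bootstrap for nearest-neighbour percolation — the printed
# logical skeleton with every hypothesis explicit (`LaceBootstrapHypotheses`, `AnalyticLeaves`)

Reproduces, as STATEMENTS over the vocabulary of this library and one bookkeeping theorem, the
structure of the computer-assisted proof of

* R. Fitzner, R. van der Hofstad, *Mean-field behavior for nearest-neighbor percolation in
  `d > 10`*, Electron. J. Probab. **22** (2017), paper no. 43, 1–65 [FvdH17] (arXiv:1506.07977), and
* R. Fitzner, R. van der Hofstad, *Generalized approach to the non-backtracking lace expansion*,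
  Probab. Theory Related Fields **169** (2017), 1041–1119 [NoBLE17] (arXiv:1506.07969),

namely [NoBLE17] §2.4 "Proof subject to a successful bootstrap" (PTRF p. 1061) with Lemma 2.1
(p. 1056), Definition 2.9 (p. 1060) and Proposition 2.11 (p. 1061), specialised to percolation by
[FvdH17] §2.4, claims (i)–(iii) (EJP p. 13), §2.6 (EJP p. 17) and Corollary 1.3 (EJP p. 6).
Page numbers in the `[cite:]` tags and all quoted text are those of the PUBLISHED versions (EJP 22 /
PTRF 169); theorem and equation numbers agree with arXiv v2 of both papers.

## What is in this file

1. `BootstrapConstants` — the table `K = (c_μ, c_{n,l,S}, γ, Γ, β, f₁ᴵ, f₂ᴵ, f₃ᴵ, f₃⁺)` of real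
   constants of one run of the verification (per dimension; the published `d = 11` values are
   `Γ₁ = 1.01306`, `γ₁ = 1.0130591`, `Γ₂ = 1.076`, [FvdH17] §2.5, EJP p. 16); the `β`-table is the
   library's `NobleBeta` (the eight constants of [NoBLE17] Assumption 2.7 consumed by Lemmas 3.2 and
   3.4; the five further constants of Assumption 2.7 enter only the second bound (2.18) of Thm. 2.10,
   which is not on the path to `θ(p_c) = 0`).
2. `LaceBootstrapHypotheses d K` — the NUMERICAL hypotheses: [NoBLE17] Def. 2.9 (2.14)–(2.16) and
   the condition on `γ₃`, read as closed inequalities between the entries of `K`, plus the sign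
   conditions `c_μ > 1`, `c_{n,l,S} > 0`, admissibility of `β`, and `7 ≤ d`.
3. `Leaf.*` / `AnalyticLeaves d K` — the ANALYTIC inputs of the skeleton, each a named `Prop` whose
   docstring quotes the published statement: `Continuity` (Prop. 2.11 / claim (i)),
   `Initialisation` (Ass. 2.2, (2.36), (3.31)), `SimplifiedForm` (Props. 2.1–2.2, Ass. 2.7,
   Prop. 4.5, Lemma 3.1), `F1F2Improvement` (Lemmas 3.2, 3.4), `F3Improvement` ((3.87)),
   `InfraredBoundOfNoble` (§2.6), `TriangleOfInfraredBound` ((1.14)), `ContinuityOfTriangle`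
   (Barsky–Aizenman / Aizenman–Newman, Cor. 1.3).
4. PROVED (bookkeeping only): `nobleBootstrapBound_of_laceBootstrap` (Lemma 2.1 + (2.17)/(2.20)),
   `percolationContinuity_of_laceBootstrap (d) (K) :
   LaceBootstrapHypotheses d K → AnalyticLeaves d K → TriangleCondition d ∧ PercolationContinuity d`.
5. Five of the eight leaves are THEOREMS of this library and are discharged here (`leaf_*`); what
   remains is `percolationContinuity_of_laceBootstrap_hybrid`, whose only hypotheses are the numerical
   table and the three HYBRID leaves `Initialisation`, `SimplifiedForm`, `F3Improvement`.
6. The mean-field exponents of [FvdH17] (1.5)–(1.8) / Cor. 1.3 (`γ = β = 1`, `δ = 2` in the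
   bounded-ratio sense) are stated in the companion file `MeanFieldExponents.lean` of this directory,
   with what the triangle condition gives for them in this library (`exponents_of_triangle`); compose
   it with `percolationContinuity_of_laceBootstrap` for the exponents from the table.
7. The link with the companion file `NobleInstantiate.lean` (same directory): its two-table numeric
   certificate `NobleNumericCertificate` and per-dimension inputs `NobleInitialInputsAt`,
   `NobleImprovementInputsAt` determine a table `K` (`BootstrapConstants.ofCertificate`) satisfying
   `LaceBootstrapHypotheses` and the three hybrid leaves (`laceBootstrapHypotheses_of_certificate`,
   `hybridLeaves_of_certificate`), so its route and this file's bookkeeping theorem agree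
   (`percolationContinuity_of_certificate'`).

## Status of the hypotheses (the rule of this reproduction)

Every hypothesis of the theorems below is EITHER a numerical inequality between the entries of `K`
(to be discharged by `norm_num` on a certified table) OR a leaf `Prop` quoting a published statement
with its page. Nothing internal to a verification run is a citable fact: once `K` carries numerals,
the hybrid leaves `Initialisation`, `SimplifiedForm`, `F3Improvement` read "the published bounds
hold with THESE constants" — a numerical evaluation of [NoBLE17] App. D and [FvdH17] §§4–6 that is
neither proved here nor a verbatim published theorem; they stay hypotheses (NOT CITABLE) until a
formalisation of those formulas replaces `K.B`, `K.f*` by functions of `(d, Γ, SRW data)`. The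
library's NAMED FACTS vendoring the `d ≥ 11` results themselves (Prop. 2.4 with its initialisation,
the inputs of the NoBLE analysis, `β = 1` for `d ≥ 11`) are deliberately NOT used anywhere in this
file: it re-derives their conclusion, per dimension, from the table and the leaves.
-/

noncomputable section

namespace Literature.Probability.FitznerVanDerHofstad2017

open Literature.Probability.LatticeModels Literature.Probability.Percolation
open Literature.Barriers.CriticalPhenomena

variable {d : ℕ}

/-! ## §1 Vocabulary (all from this library) and the triangle diagram

* `theta (zdGraph d) 0 p = θ(p)` ([FvdH17] (1.1), EJP p. 3), `criticalProb (zdGraph d) 0 = p_c`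
  (`= criticalProbI d` as a point of `[0,1]`), `tau d p x y = τ_p(x,y)` ((1.2), EJP p. 4),
  `chi d p = χ(p) = Σ_x τ_p(x)` ((1.3), EJP p. 4), `PercolationContinuity d : θ(p_c) = 0`,
  `TriangleCondition d : ∇_{p_c} < ∞` ((1.13), EJP p. 5);
* `tauHat d p k = τ̂_p(k)`, `Dhat d k = D̂(k)` ((1.9), (1.11), EJP pp. 4–5), `PercInfraredBound d`
  (`τ̂_p(k) ≤ C/|k|²` uniformly in `p < p_c`), `NobleBootstrapBound d` (the output (2.17) of
  [NoBLE17] Thm. 2.10 on `[p_I, p_c)`), `nbwThreshold d = p_I = 1/(2d-1)` (`nbwThresholdI d ∈ [0,1]`);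
* `nobleF d c_μ c i` = the bootstrap functions `f₁, f₂, f₃` of [FvdH17] (2.31)–(2.33) (EJP p. 12)
  (`nobleF1`, `nobleF2`, `nobleF3`), `NobleBeta` / `NobleBeta.Admissible` / `NobleSimplifiedFormAt`
  ([NoBLE17] Assumption 2.7, PTRF p. 1059, with Lemma 3.1, p. 1064).
-/

/-- The triangle diagram `∇_p = Σ_{x,y} τ_p(0,x) τ_p(x,y) τ_p(y,0)` at parameter `p`, as a real `tsum`
over `(x, y)` (the printed sum when the family is summable; `TriangleCondition d` is exactly the
summability of this family at `p = p_c`, and then `∇_{p_c} = triangleDiagram d (criticalProbI d)`).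
[cite: FitznerVanDerHofstad2017, (1.13), EJP p. 5] -/
def triangleDiagram (d : ℕ) (p : unitInterval) : ℝ :=
  ∑' xy : Site d × Site d, tau d p 0 xy.1 * tau d p xy.1 xy.2 * tau d p xy.2 0

/-! ## §2 The table of constants and the NUMERICAL hypotheses ([NoBLE17] Def. 2.9) -/

/-- **The constants of one run of the bootstrap verification** ([NoBLE17] §2.1 and Def. 2.9;
[FvdH17] (2.31)–(2.33) and §2.5): `c_μ` and `c = (c_{n,l,S})_{(n,l,S) ∈ 𝒮}` (indexed like
`nobleTriple`: `(0,0,𝒳), (1,0,𝒳), (1,1,𝒳), (1,2,𝒳), (1,3,𝒳), (1,6,{0})`), `γ = (γ₁,γ₂,γ₃)`,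
`Γ = (Γ₁,Γ₂,Γ₃)` (index `0 ↦` subscript `1`), the `β`-table `B` of Assumption 2.7 at `Γ`, and four
numbers: `f1Init ≥ f₁(p_I)`, `f2Init ≥ f₂(p_I)`, `f3Init` = the right-hand side of [NoBLE17] (3.31),
`f3Impr` = the right-hand side of [NoBLE17] (3.87), evaluated at `Γ`, `B`. For `d = 11` the paper
prints "`Γ₁ = 1.01306`", "`γ₁` can be taken to be `1.0130591`", "`Γ₂ = 1.076`".
[cite: FitznerVanDerHofstad2016NoBLE, Def. 2.9, PTRF p. 1060; (2.1)–(2.3), PTRF p. 1057]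
[cite: FitznerVanDerHofstad2017, (2.31)–(2.33), EJP p. 12; §2.5, EJP p. 16] -/
structure BootstrapConstants where
  /-- `c_μ > 1` in `f₁`. -/
  cμ : ℝ
  /-- `c_{n,l,S} > 0` in `f₃`, indexed like `𝒮` (`nobleTriple`). -/
  c : Fin 6 → ℝ
  /-- `(γ₁, γ₂, γ₃)` (`0 ↦ γ₁`). -/
  γ : Fin 3 → ℝ
  /-- `(Γ₁, Γ₂, Γ₃)` (`0 ↦ Γ₁`). -/
  Γ : Fin 3 → ℝ
  /-- The `β`-table of [NoBLE17] Assumption 2.7 for these `Γ` (the eight constants used by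
  Lemmas 3.2 and 3.4). -/
  B : NobleBeta
  /-- A certified upper bound for `f₁(p_I)`. -/
  f1Init : ℝ
  /-- A certified upper bound for `f₂(p_I)`. -/
  f2Init : ℝ
  /-- A certified upper bound for the right-hand side of [NoBLE17] (3.31) (initial bound on `f₃`). -/
  f3Init : ℝ
  /-- A certified upper bound for the right-hand side of [NoBLE17] (3.87) (final bound on `f₃`). -/
  f3Impr : ℝ

/-- **The NUMERICAL hypotheses of the bootstrap**: [NoBLE17] Definition 2.9 ("we say that
`P(γ,Γ,z)` holds when `f_i(z) ≤ Γ_i` for `i ∈ {1,2,3}` and the following conditions hold: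
(2.14) `0 ≤ γ_i < Γ_i` for `i = 1,2,3`, (2.15) `γ₁ ≥ max{f₁(z_I), max{β_μ, c_μ}(1+β̄_{Π^ι})/(1 -
(2d/(2d-1)) β̲_{Ψ^κ})}`, (2.16) `γ₂ ≥ ((2d-1)/(2d-2)) (β̄_{c,Φ} + β_{|α,Φ|} + β_{|R,Φ|})/(β̲_{α,F} -
β̲_{ΔR,F})`, and `γ₃` is larger than the maximum of the right-hand sides of (3.31) and (3.87)"), read
as conditions on the table `K` — the clause `f_i(z) ≤ Γ_i` being the régime hypothesis of the leaves
`SimplifiedForm` / `F3Improvement`, `f₁(z_I)` replaced by its bound `f1Init`, `f₂(z_I) ≤ γ₂` added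
(Lemma 2.1: "`f_i(z_I) ≤ γ_i`"; [FvdH17] §2.5: "The first 3 dots in the first table are the
verifications that `f_i(1/(2d-1)) ≤ γ_i` for `i = 1,2,3`") — together with "`c_μ > 1` and
`c_{n,l,S} > 0`" (after (2.3)), the admissibility of the `β`-table (Assumption 2.7 and the line
following it) and `7 ≤ d` (the range of the step infrared bound ⟹ triangle condition).
[cite: FitznerVanDerHofstad2016NoBLE, Def. 2.9 (2.14)–(2.16), PTRF p. 1060; Lemma 2.1, PTRF p. 1056; (2.3), PTRF p. 1057]
[cite: FitznerVanDerHofstad2017, §2.5, EJP p. 16] -/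
def LaceBootstrapHypotheses (d : ℕ) (K : BootstrapConstants) : Prop :=
  7 ≤ d ∧
  1 < K.cμ ∧ (∀ i, 0 < K.c i) ∧
  (∀ i, 0 ≤ K.γ i ∧ K.γ i < K.Γ i) ∧
  K.B.Admissible d ∧
  max K.f1Init (K.B.f1Bound d K.cμ) ≤ K.γ 0 ∧
  K.B.f2Bound d ≤ K.γ 1 ∧ K.f2Init ≤ K.γ 1 ∧
  K.f3Init ≤ K.γ 2 ∧ K.f3Impr ≤ K.γ 2

/-! ## §3 The ANALYTIC leaves (published statements, quoted) -/

/-- **Leaf `Continuity`** (a theorem of this library, `leaf_continuity`). [NoBLE17] Prop. 2.11: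
"… then the functions `f₁, f₂, f₃` defined in (2.1)–(2.3) are continuous"; [FvdH17] §2.4 claim (i):
"`p ↦ f_i(p)` is continuous for all `p ∈ [1/(2d-1), p_c)` and `i = 1,2,3`" (from [NoBLE17] Lemma 3.3,
"The function `z ↦ f₂(z)` defined in (2.2) is continuous for `z` in `[0,z_c)`", and Lemma 3.5, "The
function `z ↦ f₃(z)` as defined in (3.10) is continuous in `z ∈ [z_I,z_c)`"). Typed for `d ≥ 2`.
[cite: FitznerVanDerHofstad2016NoBLE, Prop. 2.11, PTRF p. 1061; Lemma 3.3, PTRF p. 1066; Lemma 3.5, PTRF p. 1068]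
[cite: FitznerVanDerHofstad2017, §2.4 claim (i), EJP p. 13] -/
def Leaf.Continuity (d : ℕ) (K : BootstrapConstants) : Prop :=
  2 ≤ d → ∀ i : Fin 3,
    ContinuousOn (nobleF d K.cμ K.c i) (Set.Ico (nbwThresholdI d) (criticalProbI d))

/-- **Leaf `Initialisation`** (HYBRID: published bounds + the certified numbers `f_iInit` — NOT
CITABLE once `K` is numeric). [NoBLE17] Assumption 2.2 (2.5): "There exists a `z_I ∈ [0,z_c)` such
that `G_z(x) ≤ B_{1/(2d-1)}(x) = ((2d-2)/(2d-1)) C_{1/(2d)}(x)` for all `x ∈ ℤ^d` and `z ∈ [0,z_I]`",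
verified for percolation by [FvdH17] (2.36): "`τ_p(x) ≤ … = B_p(x)`" for `p ≤ 1/(2d-1)`; whence
bounds on `f₁(z_I)`, `f₂(z_I)` (Assumption 2.7 at `z = z_I`, Lemma 3.4) and [NoBLE17] (3.31): "`f₃(z_I)
≤ ((2d-2)/(2d-1)) max_{(n,l,S) ∈ 𝒮} sup_{x ∈ S} J_{n,l}(x)/c_{n,l,S}`". The numbers `f_iInit` are
certified upper bounds of these right-hand sides for the run `K`.
[cite: FitznerVanDerHofstad2016NoBLE, Assumption 2.2 (2.5), PTRF p. 1058; (3.29)–(3.31), PTRF p. 1070]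
[cite: FitznerVanDerHofstad2017, (2.36), EJP p. 15; §2.5, EJP p. 16] -/
def Leaf.Initialisation (d : ℕ) (K : BootstrapConstants) : Prop :=
  nobleF1 d K.cμ (nbwThresholdI d) ≤ K.f1Init ∧ nobleF2 d (nbwThresholdI d) ≤ K.f2Init ∧
    nobleF3 d K.c (nbwThresholdI d) ≤ K.f3Init

/-- **Leaf `SimplifiedForm`** (HYBRID: published analysis + the numbers of the `β`-table `K.B` — NOT
CITABLE once `K` is numeric). For `p ∈ (p_I, p_c)` with `f_i(p) ≤ Γ_i` (`i = 1,2,3`), `τ̂_p` has the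
simplified NoBLE form with the data of [NoBLE17] Lemma 3.1 and the bounds of Assumption 2.7 with
constants `K.B` (`NobleSimplifiedFormAt`): [FvdH17] Prop. 2.1 (the non-backtracking lace expansion
for percolation) with `μ_p` (2.18), Prop. 2.2 (diagrammatic bounds on the NoBLE coefficients);
[NoBLE17] Assumption 2.7: "Let `Γ₁,Γ₂,Γ₃ ≥ 0`. Assume that `z ∈ (z_I,z_c)` is such that `f_i(z) ≤ Γ_i`
holds for all `i ∈ {1,2,3}`. Then, `Ĝ_z(k) ≥ 0` for all `k ∈ (-π,π)^d`, and the following bounds hold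
with `β_•` depending only on `Γ₁,Γ₂,Γ₃, d` and the model: (a) … (c)", obtained from the coefficient bounds
by Prop. 4.5 ("Assumptions 4.1–4.3 imply Assumption 2.7"). The VALUES in `K.B` are the run's numerics.
[cite: FitznerVanDerHofstad2017, Prop. 2.1 and (2.18), EJP p. 10; Prop. 2.2, EJP p. 11]
[cite: FitznerVanDerHofstad2016NoBLE, Assumption 2.7, PTRF p. 1059; Lemma 3.1, PTRF p. 1064; Prop. 4.5, PTRF p. 1088] -/
def Leaf.SimplifiedForm (d : ℕ) (K : BootstrapConstants) : Prop :=
  ∀ p ∈ Set.Ioo (nbwThresholdI d) (criticalProbI d),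
    (∀ i : Fin 3, nobleF d K.cμ K.c i p ≤ K.Γ i) → NobleSimplifiedFormAt d p K.B

/-- **Leaf `F1F2Improvement`** (a theorem of this library, `leaf_f1f2Improvement`). [NoBLE17]
Lemma 3.2 (Improvement of `f₁`): "Let `z ∈ (z_I,z_c)` and `γ,Γ ∈ ℝ³`. If Assumptions 2.6–2.7 and
condition `P(γ,Γ,z)` hold, then `f₁(z) ≤ γ₁`" (proof, (3.5): "`f₁(z) ≤ max{β_μ(1+β̄_{Π^ι})/(1 -
(2d/(2d-1))β̲_{Ψ^κ}), c_μ(1+β̄_{Π^ι})/(1 - (2d/(2d-1))β̲_{Ψ^κ})}`") and Lemma 3.4 (Improvement of `f₂`): "Let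
`z ∈ [z_I,z_c)` be such that Assumptions 2.6–2.7 and `P(γ,Γ,z)` hold. Then `f₂(z) ≤ γ₂`" (proof,
(3.9): "`|Ĝ_z(k)|[1-D̂(k)] ≤ (β̄_{c,Φ} + β_{|α,Φ|} + β_{|R,Φ|})/(β̲_{α,F} - β̲_{ΔR,F})`") — typed as the
two bounds `f₁ ≤ f1Bound`, `f₂ ≤ f2Bound` from the simplified form (`d ≥ 2`, `c_μ ≥ 0`); the
comparisons (2.15)–(2.16) with `γ` are in `LaceBootstrapHypotheses`.
[cite: FitznerVanDerHofstad2016NoBLE, Lemma 3.2 and (3.4)–(3.5), PTRF pp. 1065–1066; Lemma 3.4 and (3.7)–(3.9), PTRF p. 1066] -/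
def Leaf.F1F2Improvement (d : ℕ) : Prop :=
  ∀ (p : unitInterval) (B : NobleBeta) (cμ : ℝ), 2 ≤ d → B.Admissible d → 0 ≤ cμ →
    NobleSimplifiedFormAt d p B → nobleF1 d cμ p ≤ B.f1Bound d cμ ∧ nobleF2 d p ≤ B.f2Bound d

/-- **Leaf `F3Improvement`** (HYBRID: published bound (3.87) + the certified number `f3Impr` — NOT
CITABLE once `K` is numeric). [NoBLE17] §3.3, "Final bound on `f₃`": "In this section, we have
bounded `f₃` by `f₃(z) ≤ max_{(n,l,S) ∈ 𝒮} sup_{x ∈ S} {(3.71)+(3.74)+(3.77)+(3.78)+(3.86)}/c_{n,l,S}`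
(3.87). … In summary and recalling Definition 2.9, when `P(γ,Γ,z)` holds, this bound on `f₃(z)` is
smaller than `γ₃`", for `z ∈ (z_I,z_c)`
with `f_i(z) ≤ Γ_i`, the right-hand side being an explicit function of `Γ`, the `β`-table and the SRW
integrals of §3.3 and §5; `f3Impr` is a certified upper bound of it for the run `K` ([FvdH17] §2.5:
"The next three dots show that the improvement has been successful for all `p < p_c(11)`").
[cite: FitznerVanDerHofstad2016NoBLE, (3.87), PTRF p. 1079] [cite: FitznerVanDerHofstad2017, §2.5, EJP p. 16] -/
def Leaf.F3Improvement (d : ℕ) (K : BootstrapConstants) : Prop :=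
  ∀ p ∈ Set.Ioo (nbwThresholdI d) (criticalProbI d),
    (∀ i : Fin 3, nobleF d K.cμ K.c i p ≤ K.Γ i) → nobleF3 d K.c p ≤ K.f3Impr

/-- **Leaf `InfraredBoundOfNoble`** (a theorem of this library, `leaf_infraredBoundOfNoble`). The
bootstrap output on `[p_I, p_c)` gives the infrared bound `τ̂_p(k) ≤ C/|k|²` uniformly in `p < p_c`
(`d ≥ 2`): on `[p_I,p_c)` by `(2/π²)|k|²/d ≤ 1 - D̂(k)`, below `p_I` by [FvdH17] (2.36) "`τ_p(x) ≤
B_p(x)` for all `p ≤ 1/(2d-1)`"; §2.6: "Combining these steps yields the required results for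
`p ∈ [1/(2d-1), p_c)`". [cite: FitznerVanDerHofstad2017, §2.6, EJP p. 17; (2.36), EJP p. 15]
[cite: HeydenreichVanDerHofstad2017, Thm. 10.1 and (5.1.11)] -/
def Leaf.InfraredBoundOfNoble (d : ℕ) : Prop :=
  2 ≤ d → NobleBootstrapBound d → PercInfraredBound d

/-- **Leaf `TriangleOfInfraredBound`** (a theorem of this library, `leaf_triangleOfInfraredBound`).
[FvdH17] (1.14) and the sentence it sits in: "Since `△(p_c) = (τ_{p_c}⋆τ_{p_c}⋆τ_{p_c})(0) =
lim_{p↗p_c} (τ_p⋆τ_p⋆τ_p)(0) = lim_{p↗p_c} ∫_{(-π,π)^d} τ̂_p(k)³ dk/(2π)^d` (1.14), the infrared bound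
in Theorem 1.1 (which is uniform in `p < p_c`) immediately implies that the triangle condition holds".
Typed for `d ≥ 7` (where `∫ |k|^{-6} dk` converges near `0`) from the `C/|k|²` form uniformly in
`p < p_c`. [cite: FitznerVanDerHofstad2017, (1.14) and the following sentence, EJP pp. 5–6]
[cite: HeydenreichVanDerHofstad2017, Cor. 5.2] -/
def Leaf.TriangleOfInfraredBound (d : ℕ) : Prop :=
  7 ≤ d → PercInfraredBound d → TriangleCondition d

/-- **Leaf `ContinuityOfTriangle`** (a theorem of this library, `leaf_continuityOfTriangle`). The
triangle condition implies `θ(p_c) = 0`: [FvdH17] §1.3, "Aizenman and Newman [3] prove that `γ = 1`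
in the bounded-ratio sense when the so-called triangle condition … holds", "In [4]" (Barsky–Aizenman
1991) "it was shown that, under the same condition, `β = 1` and `δ = 2` in the bounded-ratio sense",
and Cor. 1.3; in particular `θ(p_c) = 0`. Typed for `d ≥ 2`.
[cite: FitznerVanDerHofstad2017, §1.3 (sentences on [3], [4]), EJP p. 5; Cor. 1.3, EJP p. 6]
[cite: BarskyAizenman1991, main theorem] [cite: HeydenreichVanDerHofstad2017, Thm. 4.1 and §4.1] -/
def Leaf.ContinuityOfTriangle (d : ℕ) : Prop :=
  2 ≤ d → TriangleCondition d → PercolationContinuity d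

/-- **The analytic leaves, bundled** (conjuncts in the order `Continuity`, `Initialisation`,
`SimplifiedForm`, `F1F2Improvement`, `F3Improvement`, `InfraredBoundOfNoble`,
`TriangleOfInfraredBound`, `ContinuityOfTriangle`). The domination
`((2d-1)/(2d-2)) [1-D̂(k)] τ̂_p(k) ≤ f₂(p)` ([NoBLE17] (2.20)) and the subcritical summability of `τ_p`
it rests on (Aizenman–Barsky, Menshikov; [FvdH17] (1.4)) are theorems of this library used directly
(`mul_tauHat_le_nobleF2`), hence not leaves. Modulo the library, the bundle is equivalent to its three
hybrid conjuncts (`analyticLeaves_iff`).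
[cite: FitznerVanDerHofstad2016NoBLE, §2.4 (2.20), PTRF p. 1061] [cite: FitznerVanDerHofstad2017, §2.4 claims (i)–(iii), EJP p. 13] -/
def AnalyticLeaves (d : ℕ) (K : BootstrapConstants) : Prop :=
  Leaf.Continuity d K ∧ Leaf.Initialisation d K ∧ Leaf.SimplifiedForm d K ∧
    Leaf.F1F2Improvement d ∧ Leaf.F3Improvement d K ∧
    Leaf.InfraredBoundOfNoble d ∧ Leaf.TriangleOfInfraredBound d ∧ Leaf.ContinuityOfTriangle d

/-! ## §4 The bookkeeping theorems ([NoBLE17] §2.4; [FvdH17] §2.4, §2.6, Cor. 1.3) -/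

/-- **Steps 1–4 of the skeleton: the table and the leaves give the NoBLE bound (2.17) on
`[p_I, p_c)`.** [NoBLE17] Prop. 2.11: "… then the functions `f₁,f₂,f₃` … are continuous, `f_i(z_I) <
γ_i` for `i ∈ {1,2,3}` hold, and `f_i(z) ≤ Γ_i` for all `i ∈ {1,2,3}` implies that `f_i(z) ≤ γ_i` for
all `i ∈ {1,2,3}`"; "Proof of Theorem 2.10 subject to Proposition 2.11. By Lemma 2.1,
`((2d-1)/(2d-2)) Ĝ_z(k)[1-D̂(k)] ≤ f₂(z) ≤ γ₂` for all `z ∈ (z_I, z_c)`. (2.20)" Here: initialisation from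
`Leaf.Initialisation` and (2.15)–(2.16); improvement on `(p_I,p_c)` from `Leaf.SimplifiedForm`,
`Leaf.F1F2Improvement`, `Leaf.F3Improvement` and (2.15)–(2.16); then the library's Lemma 2.1
(`nobleBootstrapBound_of_bootstrap`, with `γ₂ = K.γ 1`).
[cite: FitznerVanDerHofstad2016NoBLE, Prop. 2.11 and (2.20), PTRF p. 1061; Lemma 2.1, PTRF p. 1056] -/
theorem nobleBootstrapBound_of_laceBootstrap {K : BootstrapConstants}
    (hN : LaceBootstrapHypotheses d K) (hA : AnalyticLeaves d K) : NobleBootstrapBound d := by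
  obtain ⟨hd7, hcμ, -, hγΓ, hB, h215, h216, hf2I, hf3I, hf3⟩ := hN
  obtain ⟨hcont, hinit, hform, himpr12, himpr3, -, -, -⟩ := hA
  have hd2 : 2 ≤ d := le_trans (by norm_num) hd7
  -- Step 2: initialisation `f_i(p_I) ≤ γ_i`
  have h₀ : ∀ i : Fin 3, nobleF d K.cμ K.c i (nbwThresholdI d) ≤ K.γ i := by
    obtain ⟨h1, h2, h3⟩ := hinit
    intro i
    fin_cases i
    · exact h1.trans ((le_max_left _ _).trans h215)
    · exact h2.trans hf2I
    · exact h3.trans hf3I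
  -- Step 3: improvement on `(p_I, p_c)`
  have himp : ∀ p ∈ Set.Ioo (nbwThresholdI d) (criticalProbI d),
      (∀ i : Fin 3, nobleF d K.cμ K.c i p ≤ K.Γ i) →
        ∀ i : Fin 3, nobleF d K.cμ K.c i p ≤ K.γ i := by
    intro p hp hΓ
    obtain ⟨hf1, hf2⟩ :=
      himpr12 p K.B K.cμ hd2 hB (le_of_lt (lt_trans zero_lt_one hcμ)) (hform p hp hΓ)
    intro i
    fin_cases i
    · exact hf1.trans ((le_max_right _ _).trans h215)
    · exact hf2.trans h216
    · exact (himpr3 p hp hΓ).trans hf3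
  -- Steps 1 and 4: continuity, Lemma 2.1 and the domination (2.20) by `f₂`
  refine nobleBootstrapBound_of_bootstrap hd2 (1 : Fin 3) (fun i => (hγΓ i).2) (hcont hd2) h₀ himp
    fun p hp k hk => ?_
  rw [nobleF_one]
  exact mul_tauHat_le_nobleF2 hd2 hp.2 hk

/-- The infrared bound `τ̂_p(k) ≤ C/|k|²`, uniformly in `p < p_c`, from the table and the leaves
([FvdH17] Thm. 1.1 re-derived per dimension from hypotheses; §2.6).
[cite: FitznerVanDerHofstad2017, Thm. 1.1, EJP p. 5; §2.6, EJP p. 17] -/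
theorem percInfraredBound_of_laceBootstrap {K : BootstrapConstants}
    (hN : LaceBootstrapHypotheses d K) (hA : AnalyticLeaves d K) : PercInfraredBound d :=
  hA.2.2.2.2.2.1 (le_trans (by norm_num) hN.1) (nobleBootstrapBound_of_laceBootstrap hN hA)

/-- **The bookkeeping theorem.** For every dimension `d` and every table `K`: the NUMERICAL
hypotheses `LaceBootstrapHypotheses d K` ([NoBLE17] Def. 2.9 read numerically) and the ANALYTIC leaves
`AnalyticLeaves d K` imply the triangle condition at `p_c` and `θ(p_c) = 0` for nearest-neighbour bond
percolation on `ℤ^d`. The proof is the printed skeleton only: NoBLE bound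
(`nobleBootstrapBound_of_laceBootstrap`) ⟹ infrared bound ⟹ triangle condition (`d ≥ 7`) ⟹
continuity ([FvdH17] Cor. 1.3: "For nearest-neighbor percolation with `d ≥ 11`, the triangle condition
holds. Therefore the critical exponents `γ, β` and `δ` exist in the bounded-ratio sense, and take on
the mean-field values `γ = β = 1, δ = 2`"). [cite: FitznerVanDerHofstad2017, Cor. 1.3, EJP p. 6; §2.4 claims (i)–(iii), EJP p. 13]
[cite: FitznerVanDerHofstad2016NoBLE, §2.4, PTRF p. 1061] -/
theorem percolationContinuity_of_laceBootstrap (d : ℕ) (K : BootstrapConstants) :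
    LaceBootstrapHypotheses d K → AnalyticLeaves d K →
      TriangleCondition d ∧ PercolationContinuity d := by
  intro hN hA
  have hd7 : 7 ≤ d := hN.1
  have hIR := percInfraredBound_of_laceBootstrap hN hA
  obtain ⟨-, -, -, -, -, -, hTri, hCont⟩ := hA
  have htri : TriangleCondition d := hTri hd7 hIR
  exact ⟨htri, hCont (le_trans (by norm_num) hd7) htri⟩

/-! ## §5 The leaves that are theorems of this library, discharged -/

/-- `Leaf.Continuity` holds: [NoBLE17] Lemmas 3.3, 3.5 and the continuity of `f₁` are theorems of
this library (`continuousOn_nobleF'`). [cite: FitznerVanDerHofstad2016NoBLE, Lemma 3.3, PTRF p. 1066; Lemma 3.5, PTRF p. 1068] -/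
theorem leaf_continuity (d : ℕ) (K : BootstrapConstants) : Leaf.Continuity d K :=
  fun hd i => continuousOn_nobleF' hd K.cμ K.c i

/-- `Continuity` holds for all parameters — `_holds` alias of `leaf_continuity` above under the fact's exact name
(appended 2026-08-28, D-0026 bookkeeping: the proof term is the existing theorem of this file; no statement,
definition or attribute is edited; no new named fact; the ledger's debt table listed the fact
unproved). [cite: FitznerVanDerHofstad2016NoBLE, Lemma 3.3, PTRF p. 1066; Lemma 3.5, PTRF p. 1068] -/
theorem _root_.Literature.Probability.FitznerVanDerHofstad2017.Leaf.Continuity_holds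
    (d : ℕ) (K : BootstrapConstants) :
    Leaf.Continuity d K :=
  _root_.Literature.Probability.FitznerVanDerHofstad2017.leaf_continuity d K

/-- `Leaf.F1F2Improvement` holds: [NoBLE17] Lemmas 3.2 and 3.4 are theorems of this library
(`NobleSimplifiedFormAt.nobleF1_le_and_nobleF2_le`).
[cite: FitznerVanDerHofstad2016NoBLE, Lemma 3.2, PTRF p. 1065; Lemma 3.4, PTRF p. 1066] -/
theorem leaf_f1f2Improvement (d : ℕ) : Leaf.F1F2Improvement d :=
  fun _ _ _ hd hB hcμ h => NobleSimplifiedFormAt.nobleF1_le_and_nobleF2_le hd hB hcμ h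

/-- `F1F2Improvement` holds for all parameters — `_holds` alias of `leaf_f1f2Improvement` above under the fact's exact name
(appended 2026-08-28, D-0026 bookkeeping: the proof term is the existing theorem of this file; no statement,
definition or attribute is edited; no new named fact; the ledger's debt table listed the fact
unproved). [cite: FitznerVanDerHofstad2016NoBLE, Lemma 3.2, PTRF p. 1065; Lemma 3.4, PTRF p. 1066] -/
theorem _root_.Literature.Probability.FitznerVanDerHofstad2017.Leaf.F1F2Improvement_holds (d : ℕ) :
    Leaf.F1F2Improvement d :=
  _root_.Literature.Probability.FitznerVanDerHofstad2017.leaf_f1f2Improvement d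

/-- `Leaf.InfraredBoundOfNoble` holds (`NobleBootstrapBound.percInfraredBound`).
[cite: FitznerVanDerHofstad2017, §2.6, EJP p. 17] -/
theorem leaf_infraredBoundOfNoble (d : ℕ) : Leaf.InfraredBoundOfNoble d :=
  fun hd h => h.percInfraredBound hd

/-- `InfraredBoundOfNoble` holds for all parameters — `_holds` alias of `leaf_infraredBoundOfNoble` above under the fact's exact name
(appended 2026-08-28, D-0026 bookkeeping: the proof term is the existing theorem of this file; no statement,
definition or attribute is edited; no new named fact; the ledger's debt table listed the fact
unproved). [cite: FitznerVanDerHofstad2017, §2.6, EJP p. 17] -/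
theorem _root_.Literature.Probability.FitznerVanDerHofstad2017.Leaf.InfraredBoundOfNoble_holds
    (d : ℕ) :
    Leaf.InfraredBoundOfNoble d :=
  _root_.Literature.Probability.FitznerVanDerHofstad2017.leaf_infraredBoundOfNoble d

/-- `Leaf.TriangleOfInfraredBound` holds (`triangleCondition_of_percInfraredBound`, `d ≥ 7`).
[cite: FitznerVanDerHofstad2017, (1.14), EJP p. 5] -/
theorem leaf_triangleOfInfraredBound (d : ℕ) : Leaf.TriangleOfInfraredBound d :=
  fun hd h => triangleCondition_of_percInfraredBound hd h

/-- `TriangleOfInfraredBound` holds for all parameters — `_holds` alias of `leaf_triangleOfInfraredBound` above under the fact's exact name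
(appended 2026-08-28, D-0026 bookkeeping: the proof term is the existing theorem of this file; no statement,
definition or attribute is edited; no new named fact; the ledger's debt table listed the fact
unproved). [cite: FitznerVanDerHofstad2017, (1.14), EJP p. 5] -/
theorem _root_.Literature.Probability.FitznerVanDerHofstad2017.Leaf.TriangleOfInfraredBound_holds
    (d : ℕ) :
    Leaf.TriangleOfInfraredBound d :=
  _root_.Literature.Probability.FitznerVanDerHofstad2017.leaf_triangleOfInfraredBound d

/-- `Leaf.ContinuityOfTriangle` holds (`percolationContinuity_of_triangle`: Aizenman–Newman's `γ = 1`
and Hutchcroft's route to Barsky–Aizenman, all proved in this library).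
[cite: FitznerVanDerHofstad2017, Cor. 1.3, EJP p. 6] [cite: HeydenreichVanDerHofstad2017, §4.1] -/
theorem leaf_continuityOfTriangle (d : ℕ) : Leaf.ContinuityOfTriangle d :=
  fun hd h => percolationContinuity_of_triangle hd h

/-- `ContinuityOfTriangle` holds for all parameters — `_holds` alias of `leaf_continuityOfTriangle` above under the fact's exact name
(appended 2026-08-28, D-0026 bookkeeping: the proof term is the existing theorem of this file; no statement,
definition or attribute is edited; no new named fact; the ledger's debt table listed the fact
unproved). [cite: HeydenreichVanDerHofstad2017, §4.1] -/
theorem _root_.Literature.Probability.FitznerVanDerHofstad2017.Leaf.ContinuityOfTriangle_holds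
    (d : ℕ) :
    Leaf.ContinuityOfTriangle d :=
  _root_.Literature.Probability.FitznerVanDerHofstad2017.leaf_continuityOfTriangle d

/-- Modulo this library, the analytic leaves ARE the three hybrid ones.
[cite: FitznerVanDerHofstad2017, §2.4 claims (ii)–(iii), EJP p. 13] -/
theorem analyticLeaves_iff (d : ℕ) (K : BootstrapConstants) :
    AnalyticLeaves d K ↔
      Leaf.Initialisation d K ∧ Leaf.SimplifiedForm d K ∧ Leaf.F3Improvement d K :=
  ⟨fun h => ⟨h.2.1, h.2.2.1, h.2.2.2.2.1⟩, fun h =>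
    ⟨leaf_continuity d K, h.1, h.2.1, leaf_f1f2Improvement d, h.2.2, leaf_infraredBoundOfNoble d,
      leaf_triangleOfInfraredBound d, leaf_continuityOfTriangle d⟩⟩

/-- **The bookkeeping theorem with the library's leaves discharged**: the numerical table together
with the three HYBRID leaves (initialisation, simplified form with the `β`-table, `f₃`-improvement —
the content of the computer-assisted part (d) of [FvdH17] §2.1 and of [NoBLE17] App. D for the run
`K`; NOT CITABLE, see the file header) gives the triangle condition and `θ(p_c) = 0` in dimension `d`.
[cite: FitznerVanDerHofstad2017, §2.1 (parts (a)–(d)), EJP p. 7; Cor. 1.3, EJP p. 6] -/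
theorem percolationContinuity_of_laceBootstrap_hybrid {K : BootstrapConstants}
    (hN : LaceBootstrapHypotheses d K) (hI : Leaf.Initialisation d K)
    (hS : Leaf.SimplifiedForm d K) (h3 : Leaf.F3Improvement d K) :
    TriangleCondition d ∧ PercolationContinuity d :=
  percolationContinuity_of_laceBootstrap d K hN ((analyticLeaves_iff d K).2 ⟨hI, hS, h3⟩)

/-! ## §6 The link with the two-table certificate of `NobleInstantiate.lean` -/

/-- The table `K` determined by the data `(c_μ, c, γ, Γ, Bi, Bo, bi, bo)` of a two-table certificate
(`NobleNumericCertificate`, file `NobleInstantiate.lean`): `B := Bo` (improvement `β`-table),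
`f1Init := f1Bound(Bi)`, `f2Init := f2Bound(Bi)` ([NoBLE17] Lemmas 3.2, 3.4 run at `p_I` with the initial
table `Bi`), `f3Init := max_k bi_k/c_k`, `f3Impr := max_k bo_k/c_k` ((3.10): `f₃ = max_k sup_x ℋ / c_k`).
[cite: FitznerVanDerHofstad2016NoBLE, (3.10), PTRF p. 1067; Def. 2.9, PTRF p. 1060] -/
def BootstrapConstants.ofCertificate (d : ℕ) (cμ : ℝ) (c : Fin 6 → ℝ) (γ Γ : Fin 3 → ℝ)
    (Bi Bo : NobleBeta) (bi bo : Fin 6 → ℝ) : BootstrapConstants where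
  cμ := cμ
  c := c
  γ := γ
  Γ := Γ
  B := Bo
  f1Init := Bi.f1Bound d cμ
  f2Init := Bi.f2Bound d
  f3Init := Finset.univ.sup' Finset.univ_nonempty fun k => bi k / c k
  f3Impr := Finset.univ.sup' Finset.univ_nonempty fun k => bo k / c k

/-- A two-table numeric certificate (with `γ ≥ 0`, (2.14)) satisfies the numerical hypotheses of this
file for the table it determines (`d ≥ 7`). [cite: FitznerVanDerHofstad2016NoBLE, Def. 2.9, PTRF p. 1060] -/
theorem laceBootstrapHypotheses_of_certificate (hd : 7 ≤ d) {cμ : ℝ} {c : Fin 6 → ℝ}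
    {γ Γ : Fin 3 → ℝ} {Bi Bo : NobleBeta} {bi bo : Fin 6 → ℝ} (hγ : ∀ i, 0 ≤ γ i)
    (hN : NobleNumericCertificate d cμ c γ Γ Bi Bo bi bo) :
    LaceBootstrapHypotheses d (BootstrapConstants.ofCertificate d cμ c γ Γ Bi Bo bi bo) := by
  refine ⟨hd, hN.one_lt_cμ, hN.c_pos, fun i => ⟨hγ i, hN.γ_lt_Γ i⟩, hN.admissible,
    max_le hN.f1Bound_init_le hN.f1Bound_le, hN.f2Bound_le, hN.f2Bound_init_le, ?_, ?_⟩
  · show (Finset.univ.sup' Finset.univ_nonempty fun k => bi k / c k) ≤ γ 2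
    exact Finset.sup'_le _ _ fun k _ => hN.f3_init_le k
  · show (Finset.univ.sup' Finset.univ_nonempty fun k => bo k / c k) ≤ γ 2
    exact Finset.sup'_le _ _ fun k _ => hN.f3_le k

/-- The per-dimension inputs of `NobleInstantiate.lean` give the three HYBRID leaves of this file for
the table the certificate determines (`d ≥ 2`; `f₁, f₂` at `p_I` by Lemmas 3.2, 3.4 with `Bi`, `f₃` from
the weighted-diagram bounds). Both sides are NOT CITABLE hypotheses; this only records that they match.
[cite: FitznerVanDerHofstad2016NoBLE, Lemma 3.2, PTRF p. 1065; Lemma 3.4, PTRF p. 1066; (3.10), PTRF p. 1067] -/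
theorem hybridLeaves_of_certificate (hd : 2 ≤ d) {cμ : ℝ} {c : Fin 6 → ℝ} {γ Γ : Fin 3 → ℝ}
    {Bi Bo : NobleBeta} {bi bo : Fin 6 → ℝ} (hN : NobleNumericCertificate d cμ c γ Γ Bi Bo bi bo)
    (hI : NobleInitialInputsAt d Bi bi) (hS : NobleImprovementInputsAt d cμ c Γ Bo bo) :
    Leaf.Initialisation d (BootstrapConstants.ofCertificate d cμ c γ Γ Bi Bo bi bo) ∧
      Leaf.SimplifiedForm d (BootstrapConstants.ofCertificate d cμ c γ Γ Bi Bo bi bo) ∧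
        Leaf.F3Improvement d (BootstrapConstants.ofCertificate d cμ c γ Γ Bi Bo bi bo) := by
  have h12 := hI.1.nobleF1_le_and_nobleF2_le hd hN.admissible_init
    (zero_le_one.trans hN.one_lt_cμ.le)
  have hf3 : ∀ (p : unitInterval) (b : Fin 6 → ℝ), NobleWeightedDiagramBoundAt d p b →
      nobleF3 d c p ≤ Finset.univ.sup' Finset.univ_nonempty fun k => b k / c k :=
    fun p b hb => nobleF3_le_of_diagramBound hN.c_pos hb fun k =>
      Finset.le_sup' (fun k => b k / c k) (Finset.mem_univ k)
  exact ⟨⟨h12.1, h12.2, hf3 _ bi hI.2⟩, fun p hp hΓ => (hS p hp hΓ).1,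
    fun p hp hΓ => hf3 p bo (hS p hp hΓ).2⟩

/-- **The two routes agree**: a two-table certificate with its per-dimension inputs
(`NobleInstantiate.lean`) yields the triangle condition and `θ(p_c) = 0` THROUGH the bookkeeping
theorem of this file (compare `meanField_of_certificate` there). [cite: FitznerVanDerHofstad2017, Cor. 1.3, EJP p. 6] -/
theorem percolationContinuity_of_certificate' (hd : 7 ≤ d) {cμ : ℝ} {c : Fin 6 → ℝ}
    {γ Γ : Fin 3 → ℝ} {Bi Bo : NobleBeta} {bi bo : Fin 6 → ℝ} (hγ : ∀ i, 0 ≤ γ i)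
    (hN : NobleNumericCertificate d cμ c γ Γ Bi Bo bi bo) (hI : NobleInitialInputsAt d Bi bi)
    (hS : NobleImprovementInputsAt d cμ c Γ Bo bo) :
    TriangleCondition d ∧ PercolationContinuity d :=
  have h := hybridLeaves_of_certificate (le_trans (by norm_num) hd) hN hI hS
  percolationContinuity_of_laceBootstrap_hybrid (laceBootstrapHypotheses_of_certificate hd hγ hN)
    h.1 h.2.1 h.2.2

end Literature.Probability.FitznerVanDerHofstad2017

end
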